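import Summits.CriticalPhenomena.PercolationContinuityZ3.Theorems.Transplant.FKDoubleFanCore4NonnegP
import Summits.CriticalPhenomena.PercolationContinuityZ3.Theorems.Transplant.FKDoubleFanCore4NonnegM
import Summits.CriticalPhenomena.PercolationContinuityZ3.Theorems.Transplant.FKDoubleFanCore4NonnegPm
import HarnessLib

/-!
# Double fans, MULTIFAN₁ middles: `CORE4 ≥ 0` — the theorem `core4_nonneg`

Helper file (`--supports stmt-CriticalPhenomena-4575`), FK sub-lane `prim-bschramm-fk-3` (gen 34); builds on p205010 (kernel theorem, internal audit
signed; external expert review pending).  Pure real polynomial algebra, no sorries; standard axioms.  Memo `bschramm/prim-bschramm-fk-3/FAR-CROSS-IX.md` §6–§6i.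

`CORE4` is the all-roof endpoint polynomial of LEMMA‴ (the four-leg inequality to which `…DoubleFanMultifan` reduces cross-apex negative correlation across every
two-sided middle whose `a`-spokes precede its `b`-spokes): `Ψ(roof,roof,roof,roof) = q²(1−q)(2−q)·CORE4`, 1,863 terms in `q, t_f, w_f, t_g, w_g, t_u, w_u, t_s, w_s`.
It is non-negative on `t ≥ 0`, `q, w ∈ [0,1]` by the PIECEWISE certificate
  `CORE4 = (2−q)·V² + q(2−q)³·[t_s(w_s w_u T − U)² + t_u(w_s w_u T − S)² + T(U+S)²] + Σ_e t^e R_e`,  `V = (2−q)(w_s w_u T − U − S) + 2(1−q)·m`,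
  `T = t_f + t_g + q t_f t_g`, `U = w_f(w_g−w_s) t_u`, `S = w_g(w_f−w_u) t_s`,
with `m = w_u w_s(1−w_f) − w_f(w_g−w_s)(1−w_u)` on `P = {w_s ≤ w_g}`, its mirror `m′ = w_s w_u(1−w_g) − w_g(w_f−w_u)(1−w_s)` on `P′ = {w_u ≤ w_f}` (cells = the P-cells at
mirrored arguments), and `m = −w_f w_g(1−w_s)(1−w_u)` on `M = {w_g ≤ w_s, w_f ≤ w_u}`; the cells `R_e ≥ 0` are the lemmas of `…Core4Cert*`.  This file: `core4_nonneg` (three-region case split).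
[folklore]
-/

noncomputable section

namespace Summit.CriticalPhenomena.PercolationContinuityZ3.Theorems

namespace FK

namespace ThreeApex

/-- **`CORE4 ≥ 0`** on `t ≥ 0`, `q, w ∈ [0,1]` — the all-roof endpoint cell of LEMMA‴ (MULTIFAN₁ middles, cross-apex pair at every distance) is non-negative:
by cases `w_s ≤ w_g` (region P), else `w_u ≤ w_f` (mirror region P′), else region M. [folklore] -/
theorem core4_nonneg {q tf wf tg wg tu wu ts ws : ℝ} (hq0 : 0 ≤ q) (hq1 : q ≤ 1) (hwf0 : 0 ≤ wf) (hwf1 : wf ≤ 1) (hwg0 : 0 ≤ wg) (hwg1 : wg ≤ 1) (hwu0 : 0 ≤ wu) (hwu1 : wu ≤ 1) (hws0 : 0 ≤ ws) (hws1 : ws ≤ 1) (htf : 0 ≤ tf) (htg : 0 ≤ tg) (htu : 0 ≤ tu) (hts : 0 ≤ ts) :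
    0 ≤ core4 q tf wf tg wg tu wu ts ws := by
  rcases le_total ws wg with hPs | hMg
  · exact core4_nonneg_P hq0 hq1 hwf0 hwf1 hwg0 hwg1 hwu0 hwu1 hws0 hws1 htf htg htu hts hPs
  · rcases le_total wu wf with hPu | hMf
    · exact core4_nonneg_Pm hq0 hq1 hwf0 hwf1 hwg0 hwg1 hwu0 hwu1 hws0 hws1 htf htg htu hts hPu
    · exact core4_nonneg_M hq0 hq1 hwf0 hwf1 hwg0 hwg1 hwu0 hwu1 hws0 hws1 htf htg htu hts hMg hMf

end ThreeApex

end FK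

end Summit.CriticalPhenomena.PercolationContinuityZ3.Theorems
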